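import Literature.AlgebraicGeometry.HodgeTheory.ComplexGysinRational
import Literature.AlgebraicTopology.SingularHomology.GysinTransposition
import HarnessLib

/-!
# Route `EndoscopicMiddleDegree` · crux `IsotypicMiddleClassesAlgebraic` (stmt-HodgeConjecture-14301) —
# stub `stub_topGysinInjective` of line `IdeatorTwoSketch`

The general topological fact used by the F-side adjunction step of Line B: for a morphism
`f : Y ⟶ Z` of smooth projective complex varieties of dimensions `d`, `e`, the Gysin push-forward
in the TOP degree, `f_* = complexGysin μ hY hZ f : H^{2d}(Y(ℂ); ℂ) → H^{2e}(Z(ℂ); ℂ)`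
(`= PD_Z⁻¹ ∘ f(ℂ)_* ∘ PD_Y` through `H₀`, `complexGysin_eq_gysinMap` with `q = 0`), is injective.

Proof (Fulton, *Young Tableaux*, App. B §B.1 (5); Hatcher Thm. 3.2, Thm. 3.26): the Gysin map
through `H₀` preserves the evaluation on fundamental classes, `⟨f_* z, [Z(ℂ)]⟩ = ⟨z, [Y(ℂ)]⟩`
(`kroneckerPairing_gysinMap_fundamentalClass`), and `z ↦ ⟨z, [Y(ℂ)]⟩` is injective on
`H^{2d}(Y(ℂ); ℂ)`: the Kronecker map `H^{2d} → Hom(H_{2d}, ℂ)` is injective over a field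
(`kroneckerPairing_injective_of_field`) and `H_{2d}(Y(ℂ); ℂ) = ℂ · [Y(ℂ)]` because `Y(ℂ)` is a
closed connected oriented `2d`-manifold (`exists_eq_smul_fundamentalClass_of_connectedSpace`,
`connectedSpace_complexPoints`).
-/

-- every declaration of this problem lives in `Summit.HodgeConjecture.HodgeConjecture.…` (summit = sub-problem)
set_option linter.dupNamespace false

noncomputable section

open CategoryTheory MonoidalCategory CartesianMonoidalCategory
open Literature.AlgebraicGeometry Literature.AlgebraicGeometry.Motives
open Literature.AlgebraicGeometry.HodgeTheory
open Literature.AlgebraicTopology.SingularHomology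

namespace Summit.HodgeConjecture.HodgeConjecture.Theorems

/-- **`⟨-, [Y(ℂ)]⟩` is injective on the top line `H^{2d}(Y(ℂ); ℂ)`** (`Y` smooth projective of
dimension `d`): a top class `v` with `⟨v, [Y(ℂ)]_μ⟩ = 0` vanishes, since the Kronecker map
`H^{2d} → Hom(H_{2d}, ℂ)` is injective over the field `ℂ` (Hatcher Thm. 3.2) and
`H_{2d}(Y(ℂ); ℂ) = ℂ · [Y(ℂ)]_μ` for the closed connected `2d`-manifold `Y(ℂ)` (Hatcher Thm. 3.26).
(The same argument is the step `hdet` of `HodgeTheory.exists_eq_smul_of_top`.) -/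
theorem eq_zero_of_kroneckerPairing_fundamentalClass_eq_zero (μ : OrientationFamily) {d : ℕ}
    {Y : SchemeOver ℂ} (hY : IsSmoothProjective d Y) {v : complexBetti Y (2 * d)}
    (hv : kroneckerPairing ℂ ℂ (ComplexPoints Y) (2 * d) v (μ hY).fundamentalClass = 0) :
    v = 0 := by
  letI := hY.chartedSpace
  haveI := ComplexPoints.compactSpace_of_isSmoothProjective hY
  haveI := ComplexPoints.t2Space_of_isSmoothProjective hY
  haveI := connectedSpace_complexPoints hY
  apply kroneckerPairing_injective_of_field ℂ (ComplexPoints Y) (2 * d)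
  rw [map_zero]
  refine LinearMap.ext fun z ↦ ?_
  obtain ⟨r, rfl⟩ := exists_eq_smul_fundamentalClass_of_connectedSpace (μ hY) z
  rw [map_smul, hv, smul_zero, LinearMap.zero_apply]

/-- **The top-degree Gysin push-forward is injective.** For a morphism `f : Y ⟶ Z` of smooth
projective complex varieties of dimensions `d`, `e` and an orientation family `μ` with Poincaré
duality, `complexGysin μ hY hZ f : H^{2d}(Y(ℂ); ℂ) → H^{2e}(Z(ℂ); ℂ)` is injective: in these
degrees `f_*` is the Gysin homomorphism through `H₀` (`complexGysin_eq_gysinMap`, `q = 0`), which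
preserves the evaluation on fundamental classes, `⟨f_* z, [Z(ℂ)]⟩ = ⟨z, [Y(ℂ)]⟩`
(`kroneckerPairing_gysinMap_fundamentalClass`, Fulton App. B §B.1 (5)); and `⟨-, [Y(ℂ)]⟩` is
injective on the top line (`eq_zero_of_kroneckerPairing_fundamentalClass_eq_zero`). -/
theorem stub_topGysinInjective (μ : OrientationFamily) (hμ : μ.HasPoincareDuality)
    {d e : ℕ} {Y Z : SchemeOver ℂ} (hY : IsSmoothProjective d Y) (hZ : IsSmoothProjective e Z)
    (f : Y ⟶ Z) {a b : ℕ} (hab : a + 2 * e = b + 2 * d) (ha : a = 2 * d) :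
    Function.Injective (complexGysin μ hY hZ f hab) := by
  subst ha
  obtain rfl : b = 2 * e := by omega
  rw [complexGysin_eq_gysinMap hY hZ f hab (q := 0) (Nat.add_zero _) (Nat.add_zero _)]
  refine (injective_iff_map_eq_zero _).2 fun z hz ↦ ?_
  apply eq_zero_of_kroneckerPairing_fundamentalClass_eq_zero μ hY
  have h := kroneckerPairing_gysinMap_fundamentalClass (μY := μ hY) (hμ hZ)
    (AlgPoints.mapContinuous (L := ℂ) f) (Nat.add_zero _) (Nat.add_zero _) z
  rw [hz, map_zero, LinearMap.zero_apply] at h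
  exact h.symm

end Summit.HodgeConjecture.HodgeConjecture.Theorems

end
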